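import Summits.CriticalPhenomena.CardyFormulaZ2.Theorems.CardyFlipRussoSquareFromVoronoiHubDilutionDefs
import Literature.Analysis.FunctionSpaces.PoissonMecke
import Mathlib.MeasureTheory.Measure.Prod
import Mathlib.MeasureTheory.Measure.Dirac
import Mathlib.Probability.Distributions.SetBernoulli
import HarnessLib

/-!
# Stub `stub_latticeLaw` of the line `poisson-dilution-leg`, crux `SquareFromVoronoiHub`
# (stmt-CriticalPhenomena-6434, route `CardyFlipRusso`, sub-problem `CardyFormulaZ2`)

The `t = 0` LAW REDUCTION of the Poisson-dilution leg of
`…CardyFlipRussoSquareFromVoronoiHubDilutionDefs.lean`: for Poisson laws `PB`, `PW` of intensity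
ZERO both Poisson parts are almost surely empty — indeed `PB = PW = dirac ∅`, since the void
probability of the whole plane is `e^{-0} = 1` (`measure_count_eq_zero`) and "no point at all" is the
measurable singleton `{∅}` of the count σ-algebra —, the presence law `sitePercolation _ (σ 0)` is
`Bernoulli(1) = dirac univ` (`unitInterval.symm_zero`, `setBernoulli_one`), so that
`legMeasure 0 PB PW = (((dirac ∅) ⊗ (dirac ∅)) ⊗ ((dirac univ) ⊗ S₁)) ⊗ S₂` is the image of
`latMeasure = S₁ ⊗ S₂` under the embedding `toLeg θ = (((∅, ∅), (univ, θ.1)), θ.2)`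
(`Measure.dirac_prod_dirac`, `Measure.dirac_prod`, `Measure.map_map`, `Measure.map_prod_map`).  The map
`toLeg` is a MEASURABLE EMBEDDING (the singletons `{(∅, ∅)}` and `{univ}` are measurable), hence
`(latMeasure.map toLeg) A = latMeasure (toLeg ⁻¹' A)` for EVERY set `A`
(`MeasurableEmbedding.map_apply`, no measurability of the crossing event needed), and
`legProb 0 PB PW R δ = latProb R δ` for every conformal rectangle `R` and mesh `δ`: the registered stub
`stub_latticeLaw`.

References: J. F. C. Kingman, *Poisson Processes* (1993), §2.1 (void probabilities); G. Grimmett,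
*Percolation* (1999), §1.6 (Bernoulli site percolation); B. Bollobás, O. Riordan, *Percolation*
(CUP 2006), Ch. 8 §8.2.
-/

noncomputable section

open scoped Topology
open MeasureTheory Metric Set Filter
open Literature.Analysis.FunctionSpaces (PointConfig IsPoissonPointProcess
  existsUnique_isPoissonPointProcess_holds)
open Literature.Probability.Percolation (SiteConfig sitePercolation half blackRegion voronoiCrossing)
open Literature.Probability.RandomPlanarGeometry (ConformalRectangle cardyFunction crossRatio)
open Summit.CriticalPhenomena.CardyFormulaZ2.Cruxes.SquareFromVoronoiHub.VoronoiBlocks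
  (zGs Gs crudeCrossing siteCrossingProb voronoiCrossingProb squareFromVoronoiHub_iff)

namespace Summit.CriticalPhenomena.CardyFormulaZ2.Cruxes.SquareFromVoronoiHub.PoissonDilutionLeg

open scoped ProbabilityTheory
open ProbabilityTheory (setBernoulli_one)

/-! ### Poisson laws of intensity zero are the Dirac mass at the empty configuration -/

/-- A configuration has no point at all (`N(univ) = 0`) iff it is the empty configuration.
[folklore] -/
theorem count_univ_eq_zero_iff_eq_empty {E : Type*} [TopologicalSpace E] (c : PointConfig E) :
    c.count univ = 0 ↔ c = ∅ := by
  rw [PointConfig.count, inter_univ, encard_eq_zero]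
  constructor
  · intro h
    exact SetLike.coe_injective (h.trans PointConfig.carrier_empty.symm)
  · rintro rfl
    rfl

/-- The event "no point at all" is the singleton of the empty configuration. [folklore] -/
theorem setOf_count_univ_eq_zero {E : Type*} [TopologicalSpace E] :
    {c : PointConfig E | c.count univ = 0} = {∅} := by
  ext c
  rw [mem_setOf_eq, mem_singleton_iff, count_univ_eq_zero_iff_eq_empty]

/-- The singleton of the empty configuration is measurable for the count σ-algebra (it is the count
event `N(univ) = 0`; Kingman 1993, §2.1). [folklore] -/
theorem measurableSet_singleton_empty {E : Type*} [TopologicalSpace E] [MeasurableSpace E] :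
    MeasurableSet ({∅} : Set (PointConfig E)) := by
  rw [← setOf_count_univ_eq_zero]
  exact PointConfig.measurable_count MeasurableSet.univ (measurableSet_singleton 0)

/-- Under a Poisson law of intensity ZERO the configuration is almost surely empty: the void
probability of the whole space is `e^{-0} = 1` (Kingman 1993, §2.1). [folklore] -/
theorem measure_singleton_empty_of_zero {E : Type*} [TopologicalSpace E] [MeasurableSpace E]
    {P : Measure (PointConfig E)} (h : IsPoissonPointProcess (0 : Measure E) P) :
    P {∅} = 1 := by
  rw [← setOf_count_univ_eq_zero, h.measure_count_eq_zero MeasurableSet.univ (by simp)]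
  simp

/-- **A Poisson law of intensity zero is the Dirac mass at the empty configuration**: it gives mass
`1` to the measurable singleton `{∅}`, so every measurable event has probability `1` or `0`
according as it contains `∅` or not (Kingman 1993, §2.1). [folklore] -/
theorem eq_dirac_of_isPoissonPointProcess_zero {E : Type*} [TopologicalSpace E] [MeasurableSpace E]
    {P : Measure (PointConfig E)} (h : IsPoissonPointProcess (0 : Measure E) P) :
    P = Measure.dirac ∅ := by
  haveI := h.isProbabilityMeasure
  have h1 : P {∅} = 1 := measure_singleton_empty_of_zero h
  have h0 : P {∅}ᶜ = 0 := (prob_compl_eq_zero_iff measurableSet_singleton_empty).2 h1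
  ext A hA
  by_cases hA0 : (∅ : PointConfig E) ∈ A
  · rw [Measure.dirac_apply_of_mem hA0]
    refine le_antisymm prob_le_one ?_
    rw [← h1]
    exact measure_mono (singleton_subset_iff.2 hA0)
  · rw [Measure.dirac_apply' _ hA, indicator_of_notMem hA0]
    refine measure_mono_null (fun c hc => ?_) h0
    rintro (rfl : c = ∅)
    exact hA0 hc

/-! ### The presence law at `t = 0`: every site present -/

/-- At `t = 0` the presence law `Bernoulli(1 - 0)` is the Dirac mass at "every site present"
(`σ 0 = 1`, `setBer(univ, 1) = dirac univ`; Grimmett 1999, §1.6). [folklore] -/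
theorem sitePercolation_symm_zero (V : Type*) :
    sitePercolation V (unitInterval.symm 0) = Measure.dirac (univ : Set V) := by
  rw [unitInterval.symm_zero, sitePercolation, setBernoulli_one]

/-! ### `toLeg` is a measurable embedding and pushes `latMeasure` to `legMeasure 0` -/

/-- `Prod.mk x` is a measurable embedding as soon as the singleton `{x}` is measurable (the image of
`s` is the measurable rectangle `{x} ×ˢ s`). [folklore] -/
theorem measurableEmbedding_prodMk_left_of_measurableSet {α β : Type*} [MeasurableSpace α]
    [MeasurableSpace β] {x : α} (hx : MeasurableSet ({x} : Set α)) :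
    MeasurableEmbedding (Prod.mk x : β → α × β) where
  injective := Prod.mk_right_injective x
  measurable := measurable_prodMk_left
  measurableSet_image' := fun s hs => by
    rw [← singleton_prod]
    exact hx.prod hs

/-- `toLeg` as a product map: `toLeg = Prod.map (Prod.mk (∅, ∅) ∘ Prod.mk univ) id`. [folklore] -/
theorem toLeg_eq_prodMap :
    toLeg = Prod.map ((Prod.mk ((∅ : PointConfig ℂ), (∅ : PointConfig ℂ)) :
        SiteConfig (ℤ × ℤ) × SiteConfig (ℤ × ℤ) →
          (PointConfig ℂ × PointConfig ℂ) × (SiteConfig (ℤ × ℤ) × SiteConfig (ℤ × ℤ))) ∘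
      (Prod.mk (univ : SiteConfig (ℤ × ℤ)) : SiteConfig (ℤ × ℤ) → SiteConfig (ℤ × ℤ) × SiteConfig (ℤ × ℤ)))
      (id : SiteConfig (ℚ × ℚ) → SiteConfig (ℚ × ℚ)) := by
  funext θ
  rfl

/-- The singleton `{(∅, ∅)}` of pairs of configurations is measurable. [folklore] -/
theorem measurableSet_singleton_empty_prod :
    MeasurableSet ({((∅ : PointConfig ℂ), (∅ : PointConfig ℂ))} :
      Set (PointConfig ℂ × PointConfig ℂ)) := by
  rw [← singleton_prod_singleton]
  exact measurableSet_singleton_empty.prod measurableSet_singleton_empty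

/-- The inner embedding `s ↦ ((∅, ∅), (univ, s))` of `toLeg` is a measurable embedding
(`{(∅, ∅)}` is a measurable count event, `{univ}` a measurable singleton of the countable product
σ-algebra on `Set (ℤ × ℤ)`). [folklore] -/
theorem measurableEmbedding_toLeg_inner :
    MeasurableEmbedding (((Prod.mk ((∅ : PointConfig ℂ), (∅ : PointConfig ℂ)) :
        SiteConfig (ℤ × ℤ) × SiteConfig (ℤ × ℤ) →
          (PointConfig ℂ × PointConfig ℂ) × (SiteConfig (ℤ × ℤ) × SiteConfig (ℤ × ℤ))) ∘
      (Prod.mk (univ : SiteConfig (ℤ × ℤ)) :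
        SiteConfig (ℤ × ℤ) → SiteConfig (ℤ × ℤ) × SiteConfig (ℤ × ℤ)))) :=
  (measurableEmbedding_prodMk_left_of_measurableSet measurableSet_singleton_empty_prod).comp
    (measurableEmbedding_prodMk_left_of_measurableSet (measurableSet_singleton _))

/-- **`toLeg` is a measurable embedding.** [folklore] -/
theorem measurableEmbedding_toLeg : MeasurableEmbedding toLeg := by
  rw [toLeg_eq_prodMap]
  exact measurableEmbedding_toLeg_inner.prodMap MeasurableEmbedding.id

/-- **The `t = 0` law is the image of the lattice-end law under `toLeg`.**  For Poisson laws of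
intensity zero, `legMeasure 0 PB PW = (((dirac ∅) ⊗ (dirac ∅)) ⊗ ((dirac univ) ⊗ S₁)) ⊗ S₂
= latMeasure.map toLeg` (`dirac_prod_dirac`, `dirac_prod`, `map_map`, `map_prod_map`). [folklore] -/
theorem legMeasure_zero_eq_map_toLeg {PB PW : Measure (PointConfig ℂ)}
    (hB : IsPoissonPointProcess (0 : Measure ℂ) PB) (hW : IsPoissonPointProcess (0 : Measure ℂ) PW) :
    legMeasure 0 PB PW = latMeasure.map toLeg := by
  have hm₁ : Measurable (Prod.mk (univ : SiteConfig (ℤ × ℤ)) :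
      SiteConfig (ℤ × ℤ) → SiteConfig (ℤ × ℤ) × SiteConfig (ℤ × ℤ)) := measurable_prodMk_left
  have hm₂ : Measurable ((Prod.mk ((∅ : PointConfig ℂ), (∅ : PointConfig ℂ)) :
      SiteConfig (ℤ × ℤ) × SiteConfig (ℤ × ℤ) →
        (PointConfig ℂ × PointConfig ℂ) × (SiteConfig (ℤ × ℤ) × SiteConfig (ℤ × ℤ)))) :=
    measurable_prodMk_left
  rw [toLeg_eq_prodMap, latMeasure, ← Measure.map_prod_map _ _ (hm₂.comp hm₁) measurable_id,
    Measure.map_id, ← Measure.map_map hm₂ hm₁, ← Measure.dirac_prod, ← Measure.dirac_prod,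
    ← Measure.dirac_prod_dirac, legMeasure, eq_dirac_of_isPoissonPointProcess_zero hB,
    eq_dirac_of_isPoissonPointProcess_zero hW, sitePercolation_symm_zero]

/-- **Registered stub `stub_latticeLaw`: the `t = 0` law reduction.**  For Poisson laws of intensity
ZERO both Poisson parts are a.s. empty (`PB = PW = dirac ∅`), the presence law is `Bernoulli(1)`
(every site present), so `legMeasure 0 PB PW` is the image of `latMeasure` under the measurable
embedding `toLeg` and `legProb 0 PB PW R δ = latProb R δ` for EVERY `R`, `δ`
(`MeasurableEmbedding.map_apply`, valid for non-measurable sets). [folklore] -/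
theorem stub_latticeLaw : ∀ (PB PW : Measure (PointConfig ℂ)),
    IsPoissonPointProcess (0 : Measure ℂ) PB → IsPoissonPointProcess (0 : Measure ℂ) PW →
    ∀ (R : ConformalRectangle) (δ : ℝ), legProb 0 PB PW R δ = latProb R δ := by
  intro PB PW hB hW R δ
  rw [legProb, latProb, legMeasure_zero_eq_map_toLeg hB hW, measureReal_def, measureReal_def,
    measurableEmbedding_toLeg.map_apply]
  rfl

end Summit.CriticalPhenomena.CardyFormulaZ2.Cruxes.SquareFromVoronoiHub.PoissonDilutionLeg

end
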